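import Summits.BirchSwinnertonDyer.BirchSwinnertonDyer.Theses.QuadraticBranchSignedControl
import Literature.NumberTheory.EllipticCurves.Kobayashi2003.SignedSelmerRankBoundProofs
import Literature.NumberTheory.EllipticCurves.Kobayashi2003.SignedSelmerTorsion
import Literature.NumberTheory.EllipticCurves.LeadingTermProofs
import Literature.NumberTheory.EllipticCurves.BSDInvariantsProofs
import Literature.NumberTheory.QuadraticFields.SquareRootGenerator
import Summits.BirchSwinnertonDyer.Rank1Residual.Additive.ChiBranchLowerAscent
import HarnessLib

/-!
# Route `QuadraticBranchSignedControl` (rung K8, cell `bsd-potss`): (C1_η) — hence the Eisenstein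
# inclusion (E⁺) of crux 19242 — AT A TOWER-ONTO PAIR from two UNIT-COEFFICIENT CERTIFICATES
# ("minimal `λ`": `λ(L_p⁺(V)) = rank V(ℚ)`, `λ(L_p⁺(V,η)) = rank V^{(p*)}(ℚ)`, `μ = 0`), granted the
# Kato half (item 19241) and Kobayashi's Thm. 1.2 / Thm. 1.3 — a FRAME-FREE per-pair road

WHAT. The crux of the K8 even-main-conjecture block is the Eisenstein inclusion (E⁺)
`QuadraticBranchPlusLowerInclusionAt V p` (item 19242) — for the additive twist `W = V ⊗ χ_{p*}` this
is Kato's lower inclusion, OPEN class-wide, in print for no twist. THIS FILE gives the K8 analogue of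
the per-pair CERTIFICATE roads of the sibling routes K9 / K8-t′ (Kurihara numbers, Ш-witnesses): on
a pair `(V, p)` whose `p`-adic tower is onto, the FULL even main conjecture (C1_η)
`QuadraticBranchPlusMainConjectureAt V p` follows from
* the Kato half (RK⁺) `QuadraticBranchPlusKatoDivisibilityAt V p` (item 19241; Kobayashi Thm. 2.2 +
  4.1 at `η`, cite-level modulo the descent frame, p422507),
* Kobayashi's Thm. 1.2 and Thm. 1.3 = Thm. 4.1 at `η = 1` for `V` over `ℚ_∞` (NAMED facts
  `Kobayashi2003.thm12_signedSelmerDual_finite_torsion`, `thm41_signedCharIdeal_divisibility`),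
* and TWO UNIT-COEFFICIENT CERTIFICATES, displayed per pair and decidable by a `p`-adic computation
  (Pollack's algorithm / overconvergent modular symbols): the coefficient of `T^{rank V(ℚ)}` of
  Kobayashi's `L_p⁺(V, T)` and the coefficient of `T^{rank V^{(p*)}(ℚ)}` of the branch function
  `L_p⁺(V, η, T)` are `p`-ADIC UNITS (`hcertV`, `hcertη`) — i.e. both plus `p`-adic `L`-functions have
  `μ = 0` and the MINIMAL `λ`-invariant allowed by the Mordell–Weil ranks,
by a `λ`-SQUEEZE that needs NO descent frame and NO control theorem:
(1) `T^{rank V(ℚ)} ∣ ξ` for the characteristic power series `ξ` of `X⁺(V/ℚ_∞)` and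
`T^{rank V'(F)} ∣ g` for that of `X⁺(V'/F_∞)` — the tree's PROVED signed rank bound
`Kobayashi2003.SignedSelmerDualData.X_pow_mordellWeilRank_dvd_of_charIdeal_eq_span` (Greenberg's easy
half of control + `Sel^±(E/K_0) = Sel(E/K_0)`, any number field, any sign); (2) `rank V'(F) = rank V(ℚ)
+ rank V^{(p*)}(ℚ)` for `F ∋ √p*` quadratic (tree: `mordellWeilRank_baseChange_quadratic_holds`,
Silverman Ex. 10.16, with `d_F = p*·q²`); (3) Thm. 1.3 (`η = 1`, tower onto): `ξ ∣ L_p⁺(V)`, so with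
the `V`-certificate `ξ ~ T^{rank V(ℚ)}`; (4) (RK⁺) (tower onto): `g ∣ ξ·Lη`, so
`T^{rank V + rank V^{(p*)}} ∣ g ∣ T^{rank V}·u·Lη` forces `T^{rank V^{(p*)}} ∣ Lη`, and the
`η`-certificate makes `Lη ~ T^{rank V^{(p*)}}`; hence `g ~ ξ·Lη`, i.e. `Char X⁺(V/F_∞) = Char X⁺(V/ℚ_∞)
· (Lη)` — (C1_η) at the pair, and (E⁺) at the pair as its lower half.

WHICH ROWS. For the Gss2 partner `W` (`C • W^{(p*)} = V`, so `rank V^{(p*)}(ℚ) = rank W(ℚ) =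
r_an(W)` on the programme's rows): the `η`-certificate says `ord_p L_p⁺(V,η,0) = 0`, i.e.
`ord_p(L(W,1)/Ω_W) = 0` ((3.6)), when `r_an(W) = 0` — the UNIT ROWS of g0's
`plusLowerInclusionSurj_on_unitRows_of_decomposition` (p420208), now reached WITHOUT the descent frame
— and `ord_p` of the first `T`-derivative of `L_p⁺(V,η,T)` `= 0` when `r_an(W) = 1` (the plus-side
twin of x1b's minus-branch leading-coefficient certificates, 11/11 units at V41): rank-ONE rows of
Gss2, where NOTHING was reachable before; the `V`-certificate is the classical "`λ(L_p⁺(V)) = rank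
V(ℚ)`, `μ = 0`" on the good twist. Where a certificate fails (`p ∣ #Ш·Tam`, a `λ`-jump, `μ > 0`) the
road says nothing — those rows are the hard core of 19242.

HONEST FRAMING (cell `bsd-potss`, run/shared/lean/pub/bsd-potss/; FULL-BSD rank ≤ 1 programme, HUMAN
RULING D-0036/D-0074): TOOL THEOREMS ONLY — no definition, no named fact minted, no `sorry`, axioms
standard. CONDITIONAL on the typed reading (RK⁺) (item 19241, hypothesis position), on two NAMED
Literature facts (hypothesis position) and on the two displayed per-pair certificates (NOT supplied
here for any pair — they are kit computations to be attached as evidence per pair); class-wide the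
crux 19242 / its parent 19114 stay OPEN and are NOT closed; nothing is booked; `BSD(W, p)` is claimed
for no pair (on rank-one rows it would further need the `p`-adic Gross–Zagier residual 19116); this is
not "finishing BSD". Seat `bsd-potss-k8q-c2` (prover), g2; `--supports stmt-BirchSwinnertonDyer-19242 --as helper`.

References: [Kobayashi2003] Thm. 1.2, Thm. 1.3 (p. 2), Def. 1.1/2.1 + Thm. 2.2 (p. 5), §3 + Thm. 3.2
+ (3.4)/(3.6) (pp. 5–7), §4 + Thm. 4.1 (p. 8); [GreenbergLNM1716] §1 p. 65, §3 Lemma 3.1 (easy half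
of control); [SilvermanAEC2009] Exercise 10.16 (rank over a quadratic field); [Pollack2003] Thm. 5.6,
Prop. 6.18 (the computable plus/minus functions); [Washington1997] §13.2 (`Λ` a UFD).
-/

set_option autoImplicit false
set_option linter.dupNamespace false

noncomputable section

open scoped Classical

open CongruenceSubgroup Field WeierstrassCurve
open Literature.NumberTheory.EllipticCurves
open Literature.NumberTheory.EllipticCurves.ModularForms
open Literature.NumberTheory.GaloisRepresentations
open Summit.BirchSwinnertonDyer.Rank1Residual.Additive
open Summit.BirchSwinnertonDyer.BirchSwinnertonDyer.Theses.QuadraticBranchSignedControl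

namespace Summit.BirchSwinnertonDyer.BirchSwinnertonDyer.Theorems

/-! ## §1 `Λ`-algebra: the `λ`-squeeze in `ℤ_p⟦T⟧` -/

section Algebra

variable {p : ℕ} [Fact p.Prime]

/-- In `Λ = ℤ_p⟦T⟧`: if `T^r ∣ ξ`, `ξ ∣ L` and the coefficient of `T^r` in `L` is a unit, then
`ξ = T^r · a` with `a ∈ Λ^×` (write `ξ = T^r b`, `L = T^r b c`; the `T^r`-coefficient of `L` is
`b(0)c(0)`, so `b(0) ∈ ℤ_p^×`, so `b ∈ Λ^×`). [cite: Washington1997, §13.2 (Λ = ℤ_p⟦T⟧; units are the series with unit constant term)] -/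
theorem exists_isUnit_eq_X_pow_mul_of_dvd_of_dvd_of_isUnit_coeff {r : ℕ} {ξ L : IwasawaAlgebra p}
    (h₁ : (PowerSeries.X : IwasawaAlgebra p) ^ r ∣ ξ) (h₂ : ξ ∣ L)
    (hu : IsUnit (PowerSeries.coeff r L)) :
    ∃ a : IwasawaAlgebra p, IsUnit a ∧ ξ = PowerSeries.X ^ r * a := by
  obtain ⟨b, rfl⟩ := h₁
  obtain ⟨c, rfl⟩ := h₂
  refine ⟨b, ?_, rfl⟩
  have hcoeff : PowerSeries.coeff r (PowerSeries.X ^ r * b * c) =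
      PowerSeries.constantCoeff b * PowerSeries.constantCoeff c := by
    have h := PowerSeries.coeff_mul_X_pow (b * c) r 0
    rw [zero_add] at h
    rw [mul_assoc, PowerSeries.X_pow_mul, h, PowerSeries.coeff_zero_eq_constantCoeff, map_mul]
  rw [hcoeff] at hu
  exact PowerSeries.isUnit_iff_constantCoeff.mpr (isUnit_of_mul_isUnit_left hu)

/-- In `Λ = ℤ_p⟦T⟧`: if `T^r ∣ L` and the coefficient of `T^r` in `L` is a unit, then `L = T^r · a`
with `a ∈ Λ^×`. [cite: Washington1997, §13.2] -/
theorem exists_isUnit_eq_X_pow_mul_of_dvd_of_isUnit_coeff {r : ℕ} {L : IwasawaAlgebra p}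
    (h : (PowerSeries.X : IwasawaAlgebra p) ^ r ∣ L) (hu : IsUnit (PowerSeries.coeff r L)) :
    ∃ a : IwasawaAlgebra p, IsUnit a ∧ L = PowerSeries.X ^ r * a :=
  exists_isUnit_eq_X_pow_mul_of_dvd_of_dvd_of_isUnit_coeff h (dvd_refl L) hu

/-- **The `λ`-squeeze.** In `Λ = ℤ_p⟦T⟧`: if `T^{r₁+r₂} ∣ g`, `g ∣ ξ·L`, `ξ = T^{r₁}·a` with `a` a
unit, and the coefficient of `T^{r₂}` in `L` is a unit, then `(g) = (ξ)·(L)` as ideals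
(`T^{r₂} ∣ a·L` hence `∣ L`, so `L = T^{r₂}·b`, `b` a unit; then `g` and `ξ L = T^{r₁+r₂}·ab` divide
each other up to units). [cite: Washington1997, §13.2 (Λ a UFD)] -/
theorem span_eq_span_mul_span_of_squeeze {r₁ r₂ : ℕ} {g ξ L a : IwasawaAlgebra p}
    (hg : (PowerSeries.X : IwasawaAlgebra p) ^ (r₁ + r₂) ∣ g) (hgξ : g ∣ ξ * L)
    (ha : IsUnit a) (hξ : ξ = PowerSeries.X ^ r₁ * a)
    (hu : IsUnit (PowerSeries.coeff r₂ L)) :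
    Ideal.span {g} = Ideal.span {ξ} * Ideal.span {L} := by
  have hX0 : (PowerSeries.X : IwasawaAlgebra p) ^ r₁ ≠ 0 := pow_ne_zero _ PowerSeries.X_ne_zero
  -- `T^{r₂} ∣ L`
  have hL : (PowerSeries.X : IwasawaAlgebra p) ^ r₂ ∣ L := by
    have h1 : (PowerSeries.X : IwasawaAlgebra p) ^ r₁ * PowerSeries.X ^ r₂ ∣
        PowerSeries.X ^ r₁ * (a * L) := by
      rw [← pow_add, ← mul_assoc, ← hξ]
      exact hg.trans hgξ
    exact (ha.dvd_mul_left).mp ((mul_dvd_mul_iff_left hX0).mp h1)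
  obtain ⟨b, hb, hLb⟩ := exists_isUnit_eq_X_pow_mul_of_dvd_of_isUnit_coeff hL hu
  -- `ξ L = T^{r₁+r₂} · (a b)` and `g ~ T^{r₁+r₂}`
  have hξL : ξ * L = PowerSeries.X ^ (r₁ + r₂) * (a * b) := by
    rw [hξ, hLb, pow_add]; ring
  have hab : IsUnit (a * b) := ha.mul hb
  rw [Ideal.span_singleton_mul_span_singleton, hξL,
    Ideal.span_singleton_mul_right_unit hab, Ideal.span_singleton_eq_span_singleton]
  refine associated_of_dvd_dvd ?_ hg
  have h2 : g ∣ PowerSeries.X ^ (r₁ + r₂) * (a * b) := hξL ▸ hgξ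
  exact (hab.dvd_mul_right).mp h2

end Algebra

/-! ## §2 Ranks over the branch field: `rank V'(F) = rank V(ℚ) + rank V^{(p*)}(ℚ)` -/

section Ranks

/-- **`rank V'(F) = rank V(ℚ) + rank V^{(p*)}(ℚ)`** for a quadratic field `F ∋ θ`, `θ² = p*`, and
any `F`-model `V' = C • V_F`: Silverman Ex. 10.16 (`rank V(F) = rank V(ℚ) + rank V^{(d_F)}(ℚ)`, tree
`mordellWeilRank_baseChange_quadratic_holds`), `d_F = p*·q²` (`NumberField.exists_discr_eq_mul_sq`, `√p* ∉ ℚ` by additive-p1's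
`not_mem_range_algebraMap_of_sq_eq_pStar`), `V^{(p* q²)} ≅ V^{(p*)}` and `C • V_F ≅ V_F` (rank is invariant under admissible changes of
variables). [cite: SilvermanAEC2009, Exercise 10.16 and III.3.1(b)] -/
theorem mordellWeilRank_model_eq_add (V : WeierstrassCurve ℚ) [V.IsElliptic] {p : ℕ}
    [Fact p.Prime] (F : Type) [Field F] [NumberField F] (V' : WeierstrassCurve F)
    (hF : Module.finrank ℚ F = 2) (hθ : ∃ θ : F, θ ^ 2 = algebraMap ℚ F ((-1) ^ (p / 2) * p))
    (hC : ∃ C : VariableChange F, C • V.baseChange F = V') :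
    V'.mordellWeilRank =
      V.mordellWeilRank + (V.quadraticTwist ((-1) ^ (p / 2) * p)).mordellWeilRank := by
  obtain ⟨θ, hθ⟩ := hθ
  obtain ⟨C, rfl⟩ := hC
  obtain ⟨q, hq, hd⟩ := NumberField.exists_discr_eq_mul_sq hF
    (not_mem_range_algebraMap_of_sq_eq_pStar hθ) hθ
  obtain ⟨C₁, hC₁⟩ := V.exists_variableChange_quadraticTwist_mul_sq ((-1) ^ (p / 2) * p) q hq
  rw [WeierstrassCurve.mordellWeilRank_variableChange_holds (V.baseChange F) C,
    mordellWeilRank_baseChange_quadratic_holds V F hF, hd, ← hC₁,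
    WeierstrassCurve.mordellWeilRank_variableChange_holds _ C₁]

end Ranks

/-! ## §3 (C1_η) and (E⁺) at a tower-onto pair from the two unit-coefficient certificates -/

section Certificates

variable {V : WeierstrassCurve ℚ} [V.IsElliptic] [V.IsGloballyMinimal] {p : ℕ} [Fact p.Prime]

/-- **(C1_η) AT A TOWER-ONTO PAIR from the Kato half and two unit-coefficient certificates.**
Hypotheses: `hK` = the reading (RK⁺) `QuadraticBranchPlusKatoDivisibilityAt V p` (item 19241;
cite-level in print); `h12`, `h41` = Kobayashi's Thm. 1.2 and Thm. 1.3/4.1 (`η = 1`) as NAMED facts;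
`hsurj` = `ρ_{V,p^m}` onto for all `m`; `hcertV` = for the newform `f` of `V` SOME `L ∈ Λ` with
Kobayashi's plus interpolation property (`IsSignedPAdicLFunction f p 1 L`, i.e. `L_p⁺(V, T)`) has a
UNIT coefficient at `T^{rank V(ℚ)}`; `hcertη` = EVERY branch function `L_p⁺(V, η, T)`
(`IsQuadraticBranchPlusLFunction f p ϖ Lη`; they differ by units) has a UNIT coefficient at
`T^{rank V^{(p*)}(ℚ)}`. Conclusion: `QuadraticBranchPlusMainConjectureAt V p` — Kobayashi's even main
conjecture on the quadratic branch AT THIS PAIR, by the `λ`-squeeze of the module docstring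
(`T^{rank V} ∣ ξ ∣ L_p⁺(V)` ⟹ `ξ ~ T^{rank V}`; `T^{rank V'(F)} ∣ g ∣ ξ Lη`, `rank V'(F) = rank V +
rank V^{(p*)}` ⟹ `Lη ~ T^{rank V^{(p*)}}`, `g ~ ξ Lη`). No descent frame, no control theorem.
CONDITIONAL on the displayed inputs; asserts nothing class-wide; closes nothing.
[cite: Kobayashi2003, Thm. 1.2 and Thm. 1.3 (p. 2), Thm. 2.2 (p. 5), Thm. 4.1 and §4 (p. 8)]
[cite: GreenbergLNM1716, §1 p. 65 and §3 Lemma 3.1 (easy half of control)]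
[cite: SilvermanAEC2009, Exercise 10.16] -/
theorem quadraticBranchPlusMainConjectureAt_of_katoDivisibility_of_unitCoeffCertificates
    (hK : QuadraticBranchPlusKatoDivisibilityAt V p)
    (h12 : Kobayashi2003.thm12_signedSelmerDual_finite_torsion)
    (h41 : Kobayashi2003.thm41_signedCharIdeal_divisibility)
    (hsurj : ∀ m : ℕ, V.HasSurjectiveModNGaloisRep (p ^ m : ℕ))
    (hcertV : ∀ {N : ℕ} [NeZero N] (f : CuspForm (Gamma0 N) 2), IsNewformOf V f →
      ∃ L : IwasawaAlgebra p, Kobayashi2003.IsSignedPAdicLFunction f p 1 L ∧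
        IsUnit (PowerSeries.coeff V.mordellWeilRank L))
    (hcertη : ∀ {N : ℕ} [NeZero N] {f : CuspForm (Gamma0 N) 2}, IsNewformOf V f →
      ∀ (ϖ : ℚ), (if Even (p / 2) then (ϖ : ℝ) * V.realPeriodRat = plusPeriod f
          else (ϖ : ℝ) * V.imaginaryPeriodRat = minusPeriod f) →
      ∀ (Lη : IwasawaAlgebra p), IsQuadraticBranchPlusLFunction f p ϖ Lη →
        IsUnit (PowerSeries.coeff (V.quadraticTwist ((-1) ^ (p / 2) * p)).mordellWeilRank Lη)) :
    QuadraticBranchPlusMainConjectureAt V p := by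
  intro F _ _ V' _ κ γ κF γF N _ f hp2 hgood hap hF hθ hC hκ hγ hγc hκF hγF hζ hf ϖ hϖ Lη hL D DF
  obtain ⟨hfinF, htorF, -, hint⟩ :=
    hK F V' hp2 hgood hap hF hθ hC hκ hγ hγc hκF hγF hζ hf ϖ hϖ Lη hL D DF
  obtain ⟨hDfin, hDtor⟩ := h12 V p hp2 hgood hap κ γ hκ hγ 1 D
  haveI : Module.Finite (IwasawaAlgebra p) D.X := hDfin
  haveI : Module.Finite (IwasawaAlgebra p) DF.X := hfinF
  refine ⟨hfinF, htorF, ?_⟩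
  -- characteristic power series
  obtain ⟨ξ, hξ⟩ := (charIdeal_isPrincipal_holds p D.X).principal
  have hξ' : D.charIdeal = Ideal.span {ξ} := hξ
  obtain ⟨g, hg⟩ := (charIdeal_isPrincipal_holds p DF.X).principal
  have hg' : DF.charIdeal = Ideal.span {g} := hg
  -- rank bounds (Greenberg's easy half of control, signed): `T^{rank V(ℚ)} ∣ ξ`, `T^{rank V'(F)} ∣ g`
  have hξdvd : (PowerSeries.X : IwasawaAlgebra p) ^ V.mordellWeilRank ∣ ξ :=
    D.X_pow_mordellWeilRank_dvd_of_charIdeal_eq_span hγ hDtor hξ'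
  have hgdvd : (PowerSeries.X : IwasawaAlgebra p) ^ V'.mordellWeilRank ∣ g :=
    DF.X_pow_mordellWeilRank_dvd_of_charIdeal_eq_span hγF htorF hg'
  rw [mordellWeilRank_model_eq_add V F V' hF hθ hC] at hgdvd
  -- the `V`-side: Thm. 1.3 (`η = 1`, tower onto) and the `V`-certificate pin `ξ ~ T^{rank V(ℚ)}`
  obtain ⟨Lp, hLp, hcoefV⟩ := hcertV f hf
  have hLpmem : Lp ∈ D.charIdeal := (h41 V p hp2 hgood hap f hf κ γ hκ hγ hγc 1 Lp hLp D hDtor).2 hsurj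
  have hξLp : ξ ∣ Lp := by
    rw [hξ'] at hLpmem
    exact Ideal.mem_span_singleton.mp hLpmem
  obtain ⟨a, ha, hξa⟩ := exists_isUnit_eq_X_pow_mul_of_dvd_of_dvd_of_isUnit_coeff hξdvd hξLp hcoefV
  -- the Kato half at `η` (tower onto): `g ∣ ξ · Lη`
  have hgξ : g ∣ ξ * Lη := by
    have h := hint hsurj
    rw [hξ', hg', Ideal.span_singleton_mul_span_singleton,
      Ideal.span_singleton_le_span_singleton] at h
    exact h
  -- squeeze
  rw [hg', hξ']
  exact span_eq_span_mul_span_of_squeeze hgdvd hgξ ha hξa (hcertη hf ϖ hϖ Lη hL)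

/-- **(E⁺) at a tower-onto pair from the Kato half and the two unit-coefficient certificates** —
the content of crux 19242 at this pair, as the lower half of the previous theorem
(`quadraticBranchPlusLowerInclusionAt_of_plusMainConjectureAt`). CONDITIONAL; closes nothing.
[cite: Kobayashi2003, Thm. 1.2 and Thm. 1.3 (p. 2), Thm. 4.1 and §4 (p. 8)] -/
theorem quadraticBranchPlusLowerInclusionAt_of_katoDivisibility_of_unitCoeffCertificates
    (hK : QuadraticBranchPlusKatoDivisibilityAt V p)
    (h12 : Kobayashi2003.thm12_signedSelmerDual_finite_torsion)
    (h41 : Kobayashi2003.thm41_signedCharIdeal_divisibility)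
    (hsurj : ∀ m : ℕ, V.HasSurjectiveModNGaloisRep (p ^ m : ℕ))
    (hcertV : ∀ {N : ℕ} [NeZero N] (f : CuspForm (Gamma0 N) 2), IsNewformOf V f →
      ∃ L : IwasawaAlgebra p, Kobayashi2003.IsSignedPAdicLFunction f p 1 L ∧
        IsUnit (PowerSeries.coeff V.mordellWeilRank L))
    (hcertη : ∀ {N : ℕ} [NeZero N] {f : CuspForm (Gamma0 N) 2}, IsNewformOf V f →
      ∀ (ϖ : ℚ), (if Even (p / 2) then (ϖ : ℝ) * V.realPeriodRat = plusPeriod f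
          else (ϖ : ℝ) * V.imaginaryPeriodRat = minusPeriod f) →
      ∀ (Lη : IwasawaAlgebra p), IsQuadraticBranchPlusLFunction f p ϖ Lη →
        IsUnit (PowerSeries.coeff (V.quadraticTwist ((-1) ^ (p / 2) * p)).mordellWeilRank Lη)) :
    QuadraticBranchPlusLowerInclusionAt V p :=
  quadraticBranchPlusLowerInclusionAt_of_plusMainConjectureAt
    (quadraticBranchPlusMainConjectureAt_of_katoDivisibility_of_unitCoeffCertificates hK h12 h41
      hsurj hcertV hcertη)

end Certificates

/-! ## §4 Route level: the certificate rows of crux 19242 -/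

/-- **The certificate rows of crux `PlusLowerInclusionSurjBranch` (item 19242), route-level form.**
GRANTED item 19241 `PlusKatoDivisibilityBranch` (the Kato half, cite-level) and Kobayashi's Thm. 1.2 /
Thm. 1.3 (NAMED facts), the crux holds on every tower-onto good `a_p = 0` twist `V`, `p ≥ 5`, that
carries the two unit-coefficient certificates (displayed per pair as the extra antecedents — exactly
the shape of the sibling routes' `KuriharaUnitAt` rows): `coeff_{rank V(ℚ)} L_p⁺(V, T) ∈ ℤ_p^×` for
some plus function of the newform, and `coeff_{rank V^{(p*)}(ℚ)} L_p⁺(V, η, T) ∈ ℤ_p^×` for every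
branch function. Census reading: with `W` the Gss2 partner, `rank V^{(p*)}(ℚ) = r_an(W)`; the rows are
the `μ = 0`, minimal-`λ` rows of both plus functions (for `r_an(W) = 0`: `ord_p(L(W,1)/Ω_W) = 0`; for
`r_an(W) = 1`: the first `T`-derivative of `L_p⁺(V,η,T)` is a unit). So the HARD CORE of 19242 is:
rows with `p ∣` the constant resp. linear coefficient (BSD-nontrivial rows), `λ`-jumps, `μ > 0`, and
the non-onto rows (19243). CONDITIONAL; nothing asserted for any specific pair; closes nothing.
[cite: Kobayashi2003, Thm. 1.2 and Thm. 1.3 (p. 2), Thm. 4.1 and §4 (p. 8), (3.6) (p. 7)]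
[cite: GreenbergLNM1716, §1 p. 65 and §3 Lemma 3.1] [cite: Pollack2003, Thm. 5.6 and Prop. 6.18] -/
theorem plusLowerInclusionSurj_on_unitCoeffCertificateRows
    (hK : PlusKatoDivisibilityBranch)
    (h12 : Kobayashi2003.thm12_signedSelmerDual_finite_torsion)
    (h41 : Kobayashi2003.thm41_signedCharIdeal_divisibility) :
    ∀ (V : WeierstrassCurve ℚ) [V.IsElliptic] [V.IsGloballyMinimal] (p : ℕ) [Fact p.Prime],
      5 ≤ p → V.HasGoodReductionAtPrime p → V.frobeniusTrace p = 0 →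
      (∀ m : ℕ, V.HasSurjectiveModNGaloisRep (p ^ m : ℕ)) →
      (∀ {N : ℕ} [NeZero N] (f : CuspForm (Gamma0 N) 2), IsNewformOf V f →
        ∃ L : IwasawaAlgebra p, Kobayashi2003.IsSignedPAdicLFunction f p 1 L ∧
          IsUnit (PowerSeries.coeff V.mordellWeilRank L)) →
      (∀ {N : ℕ} [NeZero N] {f : CuspForm (Gamma0 N) 2}, IsNewformOf V f →
        ∀ (ϖ : ℚ), (if Even (p / 2) then (ϖ : ℝ) * V.realPeriodRat = plusPeriod f
            else (ϖ : ℝ) * V.imaginaryPeriodRat = minusPeriod f) →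
        ∀ (Lη : IwasawaAlgebra p), IsQuadraticBranchPlusLFunction f p ϖ Lη →
          IsUnit (PowerSeries.coeff (V.quadraticTwist ((-1) ^ (p / 2) * p)).mordellWeilRank Lη)) →
      QuadraticBranchPlusLowerInclusionAt V p := by
  intro V _ _ p _ hp5 hgood hap hsurj hcertV hcertη
  exact quadraticBranchPlusLowerInclusionAt_of_katoDivisibility_of_unitCoeffCertificates
    (hK V p hp5 hgood hap) h12 h41 hsurj (fun f hf => hcertV f hf)
    (fun hf ϖ hϖ Lη hL => hcertη hf ϖ hϖ Lη hL)

/-- **Crux 19242 BY NAME from its certificate rows plus its residual rows displayed.** GRANTED 19241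
and the two named facts, `PlusLowerInclusionSurjBranch` follows from (E⁺) on the tower-onto twists
WITHOUT both certificates (`hres`: the BSD-nontrivial / `λ`-jump / `μ > 0` rows — the open core,
displayed) — the certificate rows being discharged per pair by the previous theorem once their two
unit coefficients are attached. CONDITIONAL; closes nothing.
[cite: Kobayashi2003, Thm. 1.3 (p. 2), Thm. 4.1 and §4 (p. 8)] -/
theorem plusLowerInclusionSurjBranch_of_unitCoeffCertificates_of_residualRows
    (hK : PlusKatoDivisibilityBranch)
    (h12 : Kobayashi2003.thm12_signedSelmerDual_finite_torsion)
    (h41 : Kobayashi2003.thm41_signedCharIdeal_divisibility)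
    (hres : ∀ (V : WeierstrassCurve ℚ) [V.IsElliptic] [V.IsGloballyMinimal] (p : ℕ) [Fact p.Prime],
      5 ≤ p → V.HasGoodReductionAtPrime p → V.frobeniusTrace p = 0 →
      (∀ m : ℕ, V.HasSurjectiveModNGaloisRep (p ^ m : ℕ)) →
      ¬ ((∀ {N : ℕ} [NeZero N] (f : CuspForm (Gamma0 N) 2), IsNewformOf V f →
            ∃ L : IwasawaAlgebra p, Kobayashi2003.IsSignedPAdicLFunction f p 1 L ∧
              IsUnit (PowerSeries.coeff V.mordellWeilRank L)) ∧
         (∀ {N : ℕ} [NeZero N] {f : CuspForm (Gamma0 N) 2}, IsNewformOf V f →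
            ∀ (ϖ : ℚ), (if Even (p / 2) then (ϖ : ℝ) * V.realPeriodRat = plusPeriod f
                else (ϖ : ℝ) * V.imaginaryPeriodRat = minusPeriod f) →
            ∀ (Lη : IwasawaAlgebra p), IsQuadraticBranchPlusLFunction f p ϖ Lη →
              IsUnit (PowerSeries.coeff (V.quadraticTwist ((-1) ^ (p / 2) * p)).mordellWeilRank
                Lη))) →
      QuadraticBranchPlusLowerInclusionAt V p) :
    PlusLowerInclusionSurjBranch := by
  intro V _ _ p _ hp5 hgood hap hsurj
  by_cases hc : (∀ {N : ℕ} [NeZero N] (f : CuspForm (Gamma0 N) 2), IsNewformOf V f →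
        ∃ L : IwasawaAlgebra p, Kobayashi2003.IsSignedPAdicLFunction f p 1 L ∧
          IsUnit (PowerSeries.coeff V.mordellWeilRank L)) ∧
      (∀ {N : ℕ} [NeZero N] {f : CuspForm (Gamma0 N) 2}, IsNewformOf V f →
        ∀ (ϖ : ℚ), (if Even (p / 2) then (ϖ : ℝ) * V.realPeriodRat = plusPeriod f
            else (ϖ : ℝ) * V.imaginaryPeriodRat = minusPeriod f) →
        ∀ (Lη : IwasawaAlgebra p), IsQuadraticBranchPlusLFunction f p ϖ Lη →
          IsUnit (PowerSeries.coeff (V.quadraticTwist ((-1) ^ (p / 2) * p)).mordellWeilRank Lη))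
  · exact plusLowerInclusionSurj_on_unitCoeffCertificateRows hK h12 h41 V p hp5 hgood hap hsurj hc.1
      (fun hf ϖ hϖ Lη hL => hc.2 hf ϖ hϖ Lη hL)
  · exact hres V p hp5 hgood hap hsurj hc

end Summit.BirchSwinnertonDyer.BirchSwinnertonDyer.Theorems

end
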